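import Mathlib
import Summits.Ventures.PercRepro.PuncturedLYMCapPeel

/-!
# PercRepro — THE VALUE-BLOCK (CAP) COMPOSITION LEMMA: THE THEOREM
(p10, gen 42)

`isFlow_capPeel`: in the vocabulary of PuncturedLYMCapPeel, for members `𝒞` pairwise disjoint of size `m` on `S`, a cap
`1 ≤ w < m`, a level `l`, a mass `a ≥ 0`, removal probabilities `β c ∈ [0, 1]` (`β 0 = 0`, `β c = 1` when `w·c = l + 1`),
`γ' c = (m − w + 1)·a·β(c+1)/((c+1)·w)`, `R' c = R − γ·c`, and for every block `B ⊆ 𝒞` with `w·#B ≤ l` a flow `w' B` of the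
cap-`(w−1)` instance on `S ∖ ⋃B` (members `𝒞 ∖ B`, level `l − w·#B`, row sums `R' #B − γ' #B · r_{w−1}`, column masses
`a·(1 − β #B)` on its capped columns): `capWeight 𝒞 w a β w'` is a flow of the cap-`w` instance on `S` with row sums
`R − γ·r_w(X)` and column masses `a` on the capped columns.  The added point of a row is a block point (uncapped column,
weight `0`), a point of a `(w−1)`-member (block `c+1`; `(m−w+1)·r_{w−1}` such points) or inner (the inner row sum, whose
uncapped columns carry no weight); the removed point of a column is one of the `w·c` block points or inner.
Paper proofs/P10-PEEL-g42.md §1b.  Nothing here asserts (SP).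
-/

namespace PercRepro.PuncturedLYM.Split.Peel

open Finset
variable {α : Type} [DecidableEq α]

/-- **THE CAP COMPOSITION LEMMA.** See the module docstring. -/
theorem isFlow_capPeel {S : Finset α} {𝒞 : Finset (Finset α)} (h𝒞S : ∀ C ∈ 𝒞, C ⊆ S) {m : ℕ}
    (hcard : ∀ C ∈ 𝒞, C.card = m) (hdisj : ∀ C ∈ 𝒞, ∀ C' ∈ 𝒞, C ≠ C' → Disjoint C C')
    {w : ℕ} (hw : 1 ≤ w) (hwm : w < m) {l : ℕ} {a : ℚ} (ha : 0 ≤ a)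
    {β : ℕ → ℚ} (hβ0 : β 0 = 0) (hβ : ∀ c, 0 ≤ β c ∧ β c ≤ 1) (hβtop : ∀ c, w * c = l + 1 → β c = 1)
    {γ R : ℚ} {γ' R' : ℕ → ℚ}
    (hγ' : ∀ c, γ' c = ((m : ℚ) - w + 1) * a * β (c + 1) / ((c + 1) * w)) (hR' : ∀ c, R' c = R - γ * c)
    {w' : Finset (Finset α) → Finset α → Finset α → ℚ} (hw'nn : ∀ B X Y, 0 ≤ w' B X Y)
    (hinner : ∀ B ⊆ 𝒞, w * B.card ≤ l →
      IsFlow (S \ blockUnion B) (l - w * B.card) (rowsCap (S \ blockUnion B) (l - w * B.card) (𝒞 \ B) (w - 1))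
        (fun X' => R' B.card - γ' B.card * rcount (𝒞 \ B) (w - 1) X')
        (fun Y' => if ∀ C ∈ 𝒞 \ B, (Y' ∩ C).card ≤ w - 1 then a * (1 - β B.card) else 0) (w' B)) :
    IsFlow S l (rowsCap S l 𝒞 w) (fun X => R - γ * rcount 𝒞 w X)
      (fun Y => if ∀ C ∈ 𝒞, (Y ∩ C).card ≤ w then a else 0) (capWeight 𝒞 w a β w') := by
  have hwpos : (0 : ℚ) < w := by exact_mod_cast hw
  refine ⟨?_, ?_, ?_⟩
  · -- nonnegativity
    intro X Y
    unfold capWeight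
    split_ifs
    all_goals first
      | exact le_refl (0 : ℚ)
      | exact hw'nn _ _ _
      | exact div_nonneg (mul_nonneg ha (hβ _).1) (mul_nonneg (by positivity) hwpos.le)
  · -- row sums
    intro X hX
    obtain ⟨hXS, hXc, hXcap⟩ := mem_rowsCap.1 hX
    rw [sum_sups]
    set B := blockOf 𝒞 w X with hB
    set c := rcount 𝒞 w X with hc
    set U := blockUnion B with hU
    have hBsub : B ⊆ 𝒞 := filter_subset _ _
    have hcB : B.card = c := rfl
    have hXU : (X ∩ U).card = w * c := by rw [Nat.mul_comm]; exact card_blockPts hdisj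
    have hwc : w * c ≤ l := by rw [← hXU, ← hXc]; exact card_le_card inter_subset_left
    -- the members met in `w − 1` points
    set N := 𝒞.filter (fun C => (X ∩ C).card = w - 1) with hN
    have hNB : ∀ C ∈ N, C ∉ B := by
      intro C hC hCB
      have h1 := (mem_filter.1 hC).2
      have h2 := (mem_blockOf.1 hCB).2
      omega
    -- a point of `S ∖ X` in a block member, in a `(w−1)`-member, or elsewhere
    have hdecomp := sum_filter_add_sum_filter_not (S \ X) (fun y => ∃ C ∈ B, y ∈ C)
      (fun y => capWeight 𝒞 w a β w' X (insert y X))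
    rw [← hdecomp]
    have hdecomp2 := sum_filter_add_sum_filter_not ((S \ X).filter (fun y => ¬ ∃ C ∈ B, y ∈ C))
      (fun y => ∃ C ∈ N, y ∈ C) (fun y => capWeight 𝒞 w a β w' X (insert y X))
    rw [← hdecomp2]
    -- (1) deepening a block member: the column is uncapped
    have h1 : ∑ y ∈ (S \ X).filter (fun y => ∃ C ∈ B, y ∈ C), capWeight 𝒞 w a β w' X (insert y X) = 0 := by
      apply sum_eq_zero
      intro y hy
      obtain ⟨hySX, C, hCB, hyC⟩ := mem_filter.1 hy
      have hyX : y ∉ X := (mem_sdiff.1 hySX).2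
      have hunc : ¬ ∀ C' ∈ 𝒞, ((insert y X) ∩ C').card ≤ w := by
        intro h
        have := h C (mem_blockOf.1 hCB).1
        rw [insert_inter_of_mem hyC, card_insert_of_notMem (fun h' => hyX (mem_inter.1 h').1),
          (mem_blockOf.1 hCB).2] at this
        omega
      unfold capWeight
      rw [if_pos hunc]
    -- (2) raising a `(w−1)`-member: the block grows by one
    have h2 : ∑ y ∈ ((S \ X).filter (fun y => ¬ ∃ C ∈ B, y ∈ C)).filter (fun y => ∃ C ∈ N, y ∈ C),
        capWeight 𝒞 w a β w' X (insert y X) = (N.card : ℚ) * γ' c := by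
      have hterm : ∀ y ∈ ((S \ X).filter (fun y => ¬ ∃ C ∈ B, y ∈ C)).filter (fun y => ∃ C ∈ N, y ∈ C),
          capWeight 𝒞 w a β w' X (insert y X) = a * β (c + 1) / (((c : ℚ) + 1) * w) := by
        intro y hy
        obtain ⟨hy1, C, hCN, hyC⟩ := mem_filter.1 hy
        obtain ⟨hySX, _⟩ := mem_filter.1 hy1
        have hyX : y ∉ X := (mem_sdiff.1 hySX).2
        obtain ⟨hC𝒞, hCw⟩ := mem_filter.1 hCN
        have hYC : ((insert y X) ∩ C).card = w := by
          rw [insert_inter_of_mem hyC, card_insert_of_notMem (fun h' => hyX (mem_inter.1 h').1), hCw]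
          omega
        -- the other members are untouched
        have hother : ∀ C' ∈ 𝒞, C' ≠ C → (insert y X) ∩ C' = X ∩ C' := by
          intro C' hC' hne
          apply insert_inter_of_notMem
          exact fun hyC' => (Finset.disjoint_left.1 (hdisj C' hC' C hC𝒞 hne)) hyC' hyC
        have hcapY : ∀ C' ∈ 𝒞, ((insert y X) ∩ C').card ≤ w := by
          intro C' hC'
          by_cases hne : C' = C
          · rw [hne, hYC]
          · rw [hother C' hC' hne]; exact hXcap C' hC'
        have hblock : blockOf 𝒞 w (insert y X) = insert C B := by
          ext C'
          rw [mem_blockOf, mem_insert, hB, mem_blockOf]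
          constructor
          · rintro ⟨hC', hc'⟩
            by_cases hne : C' = C
            · exact Or.inl hne
            · rw [hother C' hC' hne] at hc'; exact Or.inr ⟨hC', hc'⟩
          · rintro (rfl | ⟨hC', hc'⟩)
            · exact ⟨hC𝒞, hYC⟩
            · have hne : C' ≠ C := fun h => hNB C hCN (h ▸ mem_blockOf.2 ⟨hC', hc'⟩)
              rw [hother C' hC' hne]; exact ⟨hC', hc'⟩
        have hrc : rcount 𝒞 w (insert y X) = c + 1 := by
          unfold rcount
          rw [hblock, card_insert_of_notMem (hNB C hCN), hcB]
        have hex : ∃ y' ∈ insert y X, y' ∉ X ∧ y' ∈ blockPts 𝒞 w (insert y X) :=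
          ⟨y, mem_insert_self y X, hyX, mem_blockPts.2 ⟨mem_insert_self y X, C, hC𝒞, hYC, hyC⟩⟩
        unfold capWeight
        rw [if_neg (not_not.2 hcapY), if_pos hex, hrc]
        push_cast; rfl
      rw [sum_congr rfl hterm, sum_const, nsmul_eq_mul]
      -- the count: every `(w−1)`-member contributes its `m − w + 1` points outside `X`
      have hcount : (((S \ X).filter (fun y => ¬ ∃ C ∈ B, y ∈ C)).filter (fun y => ∃ C ∈ N, y ∈ C)).card
          = N.card * (m - w + 1) := by
        have hset : ((S \ X).filter (fun y => ¬ ∃ C ∈ B, y ∈ C)).filter (fun y => ∃ C ∈ N, y ∈ C)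
            = N.biUnion (fun C => C \ X) := by
          ext y
          simp only [mem_filter, mem_sdiff, mem_biUnion]
          constructor
          · rintro ⟨⟨⟨hyS, hyX⟩, _⟩, C, hCN, hyC⟩; exact ⟨C, hCN, hyC, hyX⟩
          · rintro ⟨C, hCN, hyC, hyX⟩
            have hC𝒞 := (mem_filter.1 hCN).1
            refine ⟨⟨⟨h𝒞S C hC𝒞 hyC, hyX⟩, ?_⟩, C, hCN, hyC⟩
            rintro ⟨C', hC'B, hyC'⟩
            have hne : C' ≠ C := fun h => hNB C hCN (h ▸ hC'B)
            exact (Finset.disjoint_left.1 (hdisj C' (hBsub hC'B) C hC𝒞 hne)) hyC' hyC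
        rw [hset, card_biUnion]
        · rw [sum_congr rfl (fun C hC => show (C \ X).card = m - w + 1 from by
            have hC𝒞 := (mem_filter.1 hC).1
            have hcw := (mem_filter.1 hC).2
            have := card_sdiff_add_card_inter C X
            rw [inter_comm] at this
            rw [hcard C hC𝒞] at this
            omega), sum_const, smul_eq_mul]
        · intro C hC C' hC' hne
          exact (hdisj C (mem_filter.1 hC).1 C' (mem_filter.1 hC').1 hne).mono sdiff_subset sdiff_subset
      rw [hcount, hγ' c]
      push_cast [Nat.cast_sub (by omega : w ≤ m)]
      ring
    -- (3) the other points: the inner flow of the block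
    have h3 : ∑ y ∈ ((S \ X).filter (fun y => ¬ ∃ C ∈ B, y ∈ C)).filter (fun y => ¬ ∃ C ∈ N, y ∈ C),
        capWeight 𝒞 w a β w' X (insert y X) = R' c - γ' c * N.card := by
      have hflow := hinner B hBsub hwc
      -- the inner row `X ∖ U`
      have hXW : X \ U ∈ rowsCap (S \ U) (l - w * c) (𝒞 \ B) (w - 1) := by
        rw [mem_rowsCap]
        refine ⟨sdiff_subset_sdiff hXS (le_refl _), ?_, ?_⟩
        · have := card_sdiff_add_card_inter X U
          rw [hXU, hXc] at this
          omega
        · intro C hC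
          obtain ⟨hC𝒞, hCB⟩ := mem_sdiff.1 hC
          have heq : (X \ U) ∩ C = X ∩ C := sdiff_blockUnion_inter_eq hdisj hBsub hC𝒞 hCB X
          rw [heq]
          have hle := hXcap C hC𝒞
          have hne : (X ∩ C).card ≠ w := fun h => hCB (mem_blockOf.2 ⟨hC𝒞, h⟩)
          omega
      have hrow := hflow.row (X \ U) hXW
      rw [sum_sups] at hrow
      -- the inner count of `(w−1)`-members is `#N`
      have hrcW : rcount (𝒞 \ B) (w - 1) (X \ U) = N.card := by
        unfold rcount
        congr 1
        ext C
        rw [mem_blockOf, mem_sdiff, hN, mem_filter]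
        constructor
        · rintro ⟨⟨hC𝒞, hCB⟩, hc'⟩
          have heq : (X \ U) ∩ C = X ∩ C := sdiff_blockUnion_inter_eq hdisj hBsub hC𝒞 hCB X
          rw [heq] at hc'; exact ⟨hC𝒞, hc'⟩
        · rintro ⟨hC𝒞, hc'⟩
          have hCB : C ∉ B := fun h => by
            have := (mem_blockOf.1 h).2; omega
          have heq : (X \ U) ∩ C = X ∩ C := sdiff_blockUnion_inter_eq hdisj hBsub hC𝒞 hCB X
          exact ⟨⟨hC𝒞, hCB⟩, by rw [heq]; exact hc'⟩
      rw [hrcW] at hrow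
      -- the inner sups of `X ∖ U`: the points of `S ∖ X` outside the block union
      have hset : (S \ U) \ (X \ U) = (S \ X).filter (fun y => ¬ ∃ C ∈ B, y ∈ C) := by
        ext y
        simp only [mem_sdiff, mem_filter, mem_blockUnion, hU]
        constructor
        · rintro ⟨⟨hyS, hyU⟩, hyXU⟩
          refine ⟨⟨hyS, fun hyX => hyXU ⟨hyX, hyU⟩⟩, ?_⟩
          rintro ⟨C, hCB, hyC⟩
          exact hyU ⟨C, hCB, hyC⟩
        · rintro ⟨⟨hyS, hyX⟩, hnB⟩
          exact ⟨⟨hyS, hnB⟩, fun h => hyX h.1⟩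
      rw [hset] at hrow
      -- split the inner row sum by the `(w−1)`-members; the first part vanishes (uncapped inner columns)
      rw [← sum_filter_add_sum_filter_not ((S \ X).filter (fun y => ¬ ∃ C ∈ B, y ∈ C)) (fun y => ∃ C ∈ N, y ∈ C)]
        at hrow
      have hzero : ∑ y ∈ ((S \ X).filter (fun y => ¬ ∃ C ∈ B, y ∈ C)).filter (fun y => ∃ C ∈ N, y ∈ C),
          w' B (X \ U) (insert y (X \ U)) = 0 := by
        apply sum_eq_zero
        intro y hy
        obtain ⟨hy1, C, hCN, hyC⟩ := mem_filter.1 hy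
        obtain ⟨hySX, hnB⟩ := mem_filter.1 hy1
        have hyX : y ∉ X := (mem_sdiff.1 hySX).2
        have hyU : y ∉ U := fun h => hnB (mem_blockUnion.1 h)
        obtain ⟨hC𝒞, hCw⟩ := mem_filter.1 hCN
        have hCB : C ∉ B := hNB C hCN
        -- the inner column `insert y (X ∖ U)` is uncapped: its inner column sum is `0`
        have hYin : insert y (X \ U) ∈ cols (S \ U) (l - w * c) := by
          rw [mem_cols]
          refine ⟨insert_subset (mem_sdiff.2 ⟨(mem_sdiff.1 hySX).1, hyU⟩) (mem_rowsCap.1 hXW).1, ?_⟩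
          rw [card_insert_of_notMem (fun h => hyX (mem_sdiff.1 h).1), (mem_rowsCap.1 hXW).2.1]
        have hcol := hflow.col _ hYin
        have hunc : ¬ ∀ C' ∈ 𝒞 \ B, ((insert y (X \ U)) ∩ C').card ≤ w - 1 := by
          intro h
          have := h C (mem_sdiff.2 ⟨hC𝒞, hCB⟩)
          have heq : (X \ U) ∩ C = X ∩ C := sdiff_blockUnion_inter_eq hdisj hBsub hC𝒞 hCB X
          rw [insert_inter_of_mem hyC, heq, card_insert_of_notMem (fun h' => hyX (mem_inter.1 h').1), hCw]
            at this
          omega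
        rw [if_neg hunc] at hcol
        exact (sum_eq_zero_iff_of_nonneg (fun X' _ => hw'nn _ _ _)).1 hcol _
          (mem_subs.2 ⟨hXW, subset_insert y _⟩)
      rw [hzero, zero_add, hcB] at hrow
      rw [← hrow]
      apply sum_congr rfl
      intro y hy
      obtain ⟨hy1, hnN⟩ := mem_filter.1 hy
      obtain ⟨hySX, hnB⟩ := mem_filter.1 hy1
      obtain ⟨hyS, hyX⟩ := mem_sdiff.1 hySX
      have hyU : y ∉ U := fun h => hnB (mem_blockUnion.1 h)
      -- the column `insert y X` is capped, keeps the block, and `y` is not a block point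
      have hcapY : ∀ C' ∈ 𝒞, ((insert y X) ∩ C').card ≤ w := by
        intro C' hC'
        by_cases hyC' : y ∈ C'
        · rw [insert_inter_of_mem hyC', card_insert_of_notMem (fun h' => hyX (mem_inter.1 h').1)]
          have hle := hXcap C' hC'
          have hne1 : (X ∩ C').card ≠ w := fun h => hnB ⟨C', mem_blockOf.2 ⟨hC', h⟩, hyC'⟩
          have hne2 : (X ∩ C').card ≠ w - 1 := fun h => hnN ⟨C', mem_filter.2 ⟨hC', h⟩, hyC'⟩
          omega
        · rw [insert_inter_of_notMem hyC']; exact hXcap C' hC'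
      have hblock : blockOf 𝒞 w (insert y X) = B := by
        ext C'
        rw [mem_blockOf, hB, mem_blockOf]
        by_cases hyC' : y ∈ C'
        · rw [insert_inter_of_mem hyC', card_insert_of_notMem (fun h' => hyX (mem_inter.1 h').1)]
          constructor
          · rintro ⟨hC', hc'⟩
            exact absurd ⟨C', mem_filter.2 ⟨hC', by omega⟩, hyC'⟩ hnN
          · rintro ⟨hC', hc'⟩
            exact absurd ⟨C', mem_blockOf.2 ⟨hC', hc'⟩, hyC'⟩ hnB
        · rw [insert_inter_of_notMem hyC']
      have hnex : ¬ ∃ y' ∈ insert y X, y' ∉ X ∧ y' ∈ blockPts 𝒞 w (insert y X) := by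
        rintro ⟨y', hy'Y, hy'X, hy'B⟩
        have : y' = y := by
          rcases mem_insert.1 hy'Y with h | h
          · exact h
          · exact absurd h hy'X
        subst this
        obtain ⟨_, C', hC', hc', hy'C'⟩ := mem_blockPts.1 hy'B
        rw [insert_inter_of_mem hy'C', card_insert_of_notMem (fun h' => hy'X (mem_inter.1 h').1)] at hc'
        exact hnN ⟨C', mem_filter.2 ⟨hC', by omega⟩, hy'C'⟩
      unfold capWeight
      rw [if_neg (not_not.2 hcapY), if_neg hnex, hblock]
      congr 1
      ext z
      simp only [mem_sdiff, mem_insert]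
      constructor
      · rintro ⟨(rfl | hzX), hzU⟩
        · exact Or.inl rfl
        · exact Or.inr ⟨hzX, hzU⟩
      · rintro (rfl | ⟨hzX, hzU⟩)
        · exact ⟨Or.inl rfl, hyU⟩
        · exact ⟨Or.inr hzX, hzU⟩
    rw [h1, h2, h3, zero_add, hR' c]
    ring
  · -- column sums
    intro Y hY
    obtain ⟨hYS, hYc⟩ := mem_cols.1 hY
    have hrows : ∀ X ∈ rowsCap S l 𝒞 w, X.card = l := fun X hX => (mem_rowsCap.1 hX).2.1
    rw [sum_subs_eq hrows hYc]
    by_cases hcap : ∀ C ∈ 𝒞, (Y ∩ C).card ≤ w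
    · rw [if_pos hcap]
      -- every one-point deletion of a capped column is a row
      have hfil : Y.filter (fun y => Y.erase y ∈ rowsCap S l 𝒞 w) = Y := by
        apply filter_true_of_mem
        intro y hy
        rw [mem_rowsCap]
        refine ⟨(erase_subset y Y).trans hYS, by rw [card_erase_of_mem hy, hYc]; rfl, ?_⟩
        intro C hC
        exact (card_le_card (inter_subset_inter_right (erase_subset y Y))).trans (hcap C hC)
      rw [hfil]
      set B := blockOf 𝒞 w Y with hB
      set c := rcount 𝒞 w Y with hc
      set U := blockUnion B with hU
      have hBsub : B ⊆ 𝒞 := filter_subset _ _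
      have hPts : blockPts 𝒞 w Y = Y ∩ U := rfl
      have hcardPts : (Y ∩ U).card = w * c := by rw [Nat.mul_comm]; exact card_blockPts hdisj
      have hcB : B.card = c := rfl
      -- split `Y` into the block points and the rest
      have hsplit : Y = Y ∩ U ∪ (Y \ U) := by
        ext z; simp only [mem_union, mem_inter, mem_sdiff]; tauto
      have hdis : Disjoint (Y ∩ U) (Y \ U) := disjoint_sdiff.mono_left inter_subset_right
      rw [hsplit, sum_union hdis, ← hsplit]
      -- the block removals
      have h1 : ∑ y ∈ Y ∩ U, capWeight 𝒞 w a β w' (Y.erase y) Y = a * β c := by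
        have hterm : ∀ y ∈ Y ∩ U, capWeight 𝒞 w a β w' (Y.erase y) Y = a * β c / ((c : ℚ) * w) := by
          intro y hy
          have hex : ∃ y' ∈ Y, y' ∉ Y.erase y ∧ y' ∈ blockPts 𝒞 w Y :=
            ⟨y, (mem_inter.1 hy).1, notMem_erase y Y, by rw [hPts]; exact hy⟩
          unfold capWeight
          rw [if_neg (not_not.2 hcap), if_pos hex]
        rw [sum_congr rfl hterm, sum_const, hcardPts, nsmul_eq_mul]
        by_cases hc0 : c = 0
        · rw [hc0, hβ0]; simp
        · have hcpos : (0 : ℚ) < c := by exact_mod_cast Nat.pos_of_ne_zero hc0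
          have hne : ((c : ℚ) * w) ≠ 0 := by positivity
          push_cast
          field_simp
      -- the inner removals
      have h2 : ∑ y ∈ Y \ U, capWeight 𝒞 w a β w' (Y.erase y) Y = a * (1 - β c) := by
        have hterm : ∀ y ∈ Y \ U, capWeight 𝒞 w a β w' (Y.erase y) Y = w' B ((Y \ U).erase y) (Y \ U) := by
          intro y hy
          obtain ⟨hyY, hyU⟩ := mem_sdiff.1 hy
          have hnex : ¬ ∃ y' ∈ Y, y' ∉ Y.erase y ∧ y' ∈ blockPts 𝒞 w Y := by
            rintro ⟨y', hy'Y, hy'e, hy'B⟩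
            have : y' = y := by
              by_contra hne
              exact hy'e (mem_erase.2 ⟨hne, hy'Y⟩)
            subst this
            exact hyU (mem_inter.1 hy'B).2
          unfold capWeight
          rw [if_neg (not_not.2 hcap), if_neg hnex]
          congr 1
          ext z
          simp only [mem_sdiff, mem_erase]
          tauto
        rw [sum_congr rfl hterm]
        by_cases hwc : w * c ≤ l
        · have hflow := hinner B hBsub hwc
          have hYW : Y \ U ∈ cols (S \ U) (l - w * c) := by
            rw [mem_cols]
            refine ⟨sdiff_subset_sdiff hYS (le_refl _), ?_⟩
            have := card_sdiff_add_card_inter Y U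
            rw [hcardPts, hYc] at this
            omega
          have hcol := hflow.col (Y \ U) hYW
          have hcapW : ∀ C ∈ 𝒞 \ B, ((Y \ U) ∩ C).card ≤ w - 1 := by
            intro C hC
            obtain ⟨hC𝒞, hCB⟩ := mem_sdiff.1 hC
            have heq : (Y \ U) ∩ C = Y ∩ C := sdiff_blockUnion_inter_eq hdisj hBsub hC𝒞 hCB Y
            rw [heq]
            have hle := hcap C hC𝒞
            have hne : (Y ∩ C).card ≠ w := fun h => hCB (mem_blockOf.2 ⟨hC𝒞, h⟩)
            omega
          rw [if_pos hcapW, hcB] at hcol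
          rw [← hcol]
          have hrows' : ∀ X ∈ rowsCap (S \ U) (l - w * c) (𝒞 \ B) (w - 1), X.card = l - w * c :=
            fun X hX => (mem_rowsCap.1 hX).2.1
          rw [sum_subs_eq hrows' (mem_cols.1 hYW).2]
          have hfil' : (Y \ U).filter (fun y => (Y \ U).erase y ∈ rowsCap (S \ U) (l - w * c) (𝒞 \ B) (w - 1))
              = Y \ U := by
            apply filter_true_of_mem
            intro y hy
            rw [mem_rowsCap]
            refine ⟨(erase_subset y _).trans (mem_cols.1 hYW).1, ?_, ?_⟩
            · rw [card_erase_of_mem hy, (mem_cols.1 hYW).2]; rfl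
            · intro C hC
              exact (card_le_card (inter_subset_inter_right (erase_subset y _))).trans (hcapW C hC)
          rw [hfil']
        · -- the column consists of block points only: `β c = 1`
          have hcd := card_sdiff_add_card_inter Y U
          rw [hcardPts, hYc] at hcd
          have hwc' : w * c = l + 1 := by omega
          have hempty : Y \ U = ∅ := by
            rw [← card_eq_zero]; omega
          rw [hempty, sum_empty, hβtop c hwc']
          ring
      rw [h1, h2]; ring
    · -- an uncapped column: every weight vanishes
      rw [if_neg hcap]
      apply sum_eq_zero
      intro y _
      unfold capWeight
      rw [if_pos hcap]

end PercRepro.PuncturedLYM.Split.Peel
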